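import Literature.Topology.FourManifolds.ConcordanceTransitivity
import HarnessLib

/-!
# Straightening a concordance near both ends

Topic `Literature/Topology/FourManifolds` (trunk T-4MAN); sequel of `ConcordanceStraightening.lean`
(inner end: `Knot.Straightening.exists_isConcordance_radial`, Kosinski (1993), II (2.8.2): a neat
submanifold is vertical in a suitable collar of the boundary) and `ConcordanceTransitivity.lean`
(the radial reflection `Knot.IsConcordance.reflect`, exchanging the two ends and carrying cones
to cones). Proved here:

* `Literature.Topology.FourManifolds.Knot.Straightening.isConcordance_comp_shearDiffeo_symm`,
  `Literature.Topology.FourManifolds.Knot.Straightening.exists_isConcordance_radial_eqOn` — the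
  two steps of `ConcordanceStraightening.lean` (re-timing by the shear of `RetimeData`, then
  freezing the angular part) re-run with one more conclusion recorded: **the straightened
  concordance agrees with the given one for `t ≥ 3/2`** (the shear is the identity there,
  `RetimeData.shearDiffeo_symm_of_ge`, and the freezing only acts on `t ≤ 1 + 2δ ≤ 9/8`). The
  proofs are those of `exists_isConcordance_norm_eq` / `exists_isConcordance_radial` verbatim;
  that file is not modified (append-free sibling).
* `Literature.Topology.FourManifolds.Knot.IsConcordance.reflect_cone'`,
  `Literature.Topology.FourManifolds.Knot.IsConcordance.reflect_cone_inner` — the reflection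
  exchanges inner cones `s • K x`, `s ∈ [1 - δ, 1 + δ]`, and outer cones `t • K x`,
  `t ∈ [2 - δ, 2 + δ]` (two-sided companions of `reflect_cone`).
* `Literature.Topology.FourManifolds.Knot.IsConcordance.exists_radial_both` — **two-ended
  straightening**: every concordance from `K` to `K'` can be replaced by one which is the cone
  `t • K x` for `t ∈ [1 - δ, 1 + δ]` *and* the cone `t • K' x` for `t ∈ [2 - δ, 2 + δ]`, some
  `0 < δ ≤ 1/4`: straighten the inner end, reflect, straighten the new inner end without
  touching `t ≥ 3/2` (so the reflected cone at the outer end survives), reflect back; and its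
  existence form `Literature.Topology.FourManifolds.Knot.IsConcordant.exists_radial_both`. The
  cones extend a little outside the annulus `1 ≤ t ≤ 2`, which gives room for local arguments at
  the two seams (the values of a concordance off the annulus are otherwise unconstrained).

* `Literature.Topology.FourManifolds.Knot.IsConcordance.exists_conical` — the representative
  may moreover be taken **conical at all times beyond the seams** (`t • K x` for all
  `t ≤ 1 + δ`, `t • K' x` for all `t ≥ 2 - δ`; the values of a concordance off the annulus
  `1 ≤ t ≤ 2` are unconstrained by `Knot.IsConcordance`, and `Knot.conical` resets them).

This is the collar normal form at both boundary components (Kosinski (1993), II (2.8.2) applied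
to `S³ × {1}` and `S³ × {2}`), the form in which concordances are stacked, banded and tubed in
the decomposition of the Fox–Milnor congruence `Knot.IsConnectedSum.isConcordant`
(`BandSumConcordance.lean`).

## References

* A. A. Kosinski, *Differential Manifolds* (1993), I §7, II (2.8.2). [Kosinski1993]
* R. H. Fox, J. W. Milnor, *Singularities of 2-spheres in 4-space and cobordism of knots*, Osaka
  J. Math. 3 (1966), 257–267, §1. [FoxMilnor1966]

## Design notes

* No new definitions of mathematical notions; no named facts; no `sorry`; no statement of another
  file is modified. Notation `𝔼 n`, `𝕊 n` is local, byte-identical to `SliceRibbon.lean`.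
-/

open scoped Manifold ContDiff Topology
open Function Set

noncomputable section

namespace Literature.Topology.FourManifolds

/-- Local notation: `𝔼 n` is the model Euclidean space `EuclideanSpace ℝ (Fin n)`. -/
local notation "𝔼 " n:arg => EuclideanSpace ℝ (Fin n)

/-- Local notation: `𝕊 n` is the unit sphere in `EuclideanSpace ℝ (Fin (n + 1))`. -/
local notation "𝕊 " n:arg => (Metric.sphere (0 : EuclideanSpace ℝ (Fin (n + 1))) 1)

namespace Knot

namespace Straightening

variable {f : (𝕊 1) × ℝ → 𝔼 4}

/-- **Step 1 for a given re-timing datum.** For a concordance `f` from `K` to `K'` and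
`d : RetimeData f`, the re-timed annulus `f ∘ Φ⁻¹` (`Φ = d.shearDiffeo`) is a concordance from
`K` to `K'`, level preserving (`‖f₁ (x, ρ)‖ = ρ`) for `ρ ∈ [1, 1 + η]`, some `η > 0`. This is
`exists_isConcordance_norm_eq` of `ConcordanceStraightening.lean` with the datum exposed (same
proof). Kosinski (1993), II (2.8.2). [cite: Kosinski1993, II (2.8.2)] -/
theorem isConcordance_comp_shearDiffeo_symm {K K' : Knot} (hf : IsConcordance K K' f)
    (d : RetimeData f) :
    IsConcordance K K' (f ∘ d.shearDiffeo.symm) ∧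
      ∃ η : ℝ, 0 < η ∧ ∀ x : 𝕊 1, ∀ ρ ∈ Icc (1 : ℝ) (1 + η),
        ‖(f ∘ d.shearDiffeo.symm) (x, ρ)‖ = ρ := by
  obtain ⟨hfs, hfinj, hfimm, hshell, hneat, hK, hK'⟩ := hf
  set Ψ := d.shearDiffeo.symm with hΨ
  have hΨs : ContMDiff ((𝓡 1).prod 𝓘(ℝ, ℝ)) ((𝓡 1).prod 𝓘(ℝ, ℝ)) ∞ Ψ := Ψ.contMDiff
  -- `Ψ` maps the annulus into the annulus
  have hmem : ∀ x : 𝕊 1, ∀ ρ ∈ Icc (1 : ℝ) 2, (Ψ (x, ρ)).2 ∈ Icc (1 : ℝ) 2 := by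
    intro x ρ hρ
    constructor
    · rw [d.le_symm_snd_iff, d.retime_one]
      exact hρ.1
    · rw [d.symm_snd_le_iff, d.retime_of_ge x (by norm_num)]
      exact hρ.2
  have hmem' : ∀ x : 𝕊 1, ∀ ρ ∈ Ioo (1 : ℝ) 2, (Ψ (x, ρ)).2 ∈ Ioo (1 : ℝ) 2 := by
    intro x ρ hρ
    constructor
    · rw [d.lt_symm_snd_iff, d.retime_one]
      exact hρ.1
    · rw [d.symm_snd_lt_iff, d.retime_of_ge x (by norm_num)]
      exact hρ.2
  have hann : ∀ q ∈ (univ : Set (𝕊 1)) ×ˢ Icc (1 : ℝ) 2, Ψ q ∈ (univ : Set (𝕊 1)) ×ˢ Icc (1 : ℝ) 2 := by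
    rintro ⟨x, ρ⟩ ⟨-, hρ⟩
    refine ⟨mem_univ _, ?_⟩
    exact hmem x ρ hρ
  refine ⟨⟨?_, ?_, ?_, ?_, ?_, ?_, ?_⟩, ?_⟩
  · exact hfs.comp hΨs
  · intro q hq q' hq' h
    exact Ψ.injective (hfinj (hann q hq) (hann q' hq') h)
  · intro q hq
    have hdΨ : MDifferentiableAt ((𝓡 1).prod 𝓘(ℝ, ℝ)) ((𝓡 1).prod 𝓘(ℝ, ℝ)) Ψ q :=
      hΨs.mdifferentiableAt (by simp)
    have hdf : MDifferentiableAt ((𝓡 1).prod 𝓘(ℝ, ℝ)) 𝓘(ℝ, 𝔼 4) f (Ψ q) :=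
      hfs.mdifferentiableAt (by simp)
    rw [mfderiv_comp q hdf hdΨ]
    have hinj : Injective (mfderiv ((𝓡 1).prod 𝓘(ℝ, ℝ)) ((𝓡 1).prod 𝓘(ℝ, ℝ)) Ψ q) := by
      rw [← Ψ.mfderivToContinuousLinearEquiv_coe (by simp)]
      exact (Ψ.mfderivToContinuousLinearEquiv (by simp) q).injective
    exact (hfimm (Ψ q) (hann q hq)).comp hinj
  · intro x ρ hρ
    have h := hmem' x ρ hρ
    rw [comp_apply, d.shearDiffeo_symm_eq]
    exact hshell x _ h
  · intro x
    constructor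
    · -- near `ρ = 1` the re-timed annulus is level preserving: `‖f₁ (x, ρ)‖² = ρ²`
      have hev : (fun ρ ↦ ‖(f ∘ Ψ) (x, ρ)‖ ^ 2) =ᶠ[𝓝 1] fun ρ ↦ ρ ^ 2 := by
        have hlo : retime f d.l (x, 1 - d.l) < retime f d.l (x, 1) :=
          d.strictMono_retime x (by linarith [d.l_pos])
        have hhi : retime f d.l (x, 1) < retime f d.l (x, 1 + d.l) :=
          d.strictMono_retime x (by linarith [d.l_pos])
        rw [d.retime_one] at hlo hhi
        filter_upwards [Ioo_mem_nhds hlo hhi] with ρ hρ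
        have h1 : 1 - d.l < (Ψ (x, ρ)).2 := (d.lt_symm_snd_iff x ρ _).2 hρ.1
        have h2 : (Ψ (x, ρ)).2 < 1 + d.l := (d.symm_snd_lt_iff x ρ _).2 hρ.2
        rw [comp_apply, d.norm_f_symm_of_abs_le x ρ (abs_le.2 ⟨by linarith, by linarith⟩)]
      rw [hev.deriv_eq]
      norm_num
    · -- near `ρ = 2` the re-timed annulus is `f`
      have hev : (fun ρ ↦ ‖(f ∘ Ψ) (x, ρ)‖ ^ 2) =ᶠ[𝓝 2] fun ρ ↦ ‖f (x, ρ)‖ ^ 2 := by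
        filter_upwards [Ioi_mem_nhds (by norm_num : (3 / 2 : ℝ) < 2)] with ρ hρ
        rw [comp_apply, d.shearDiffeo_symm_of_ge x (le_of_lt hρ)]
      rw [hev.deriv_eq]
      exact (hneat x).2
  · intro x
    rw [comp_apply, d.shearDiffeo_symm_one, hK]
  · intro x
    rw [comp_apply, d.shearDiffeo_symm_of_ge x (by norm_num), hK']
  · -- the uniform level zone `[1, 1 + η]`, `η = min_x ‖f (x, 1 + l)‖ - 1`
    have hc : Continuous fun x : 𝕊 1 ↦ ‖f (x, 1 + d.l)‖ :=
      (hfs.continuous.comp (continuous_id.prodMk continuous_const)).norm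
    obtain ⟨x₀, -, hx₀⟩ :=
      isCompact_univ.exists_isMinOn ⟨circlePoint 0, mem_univ _⟩ hc.continuousOn
    refine ⟨‖f (x₀, 1 + d.l)‖ - 1, ?_, fun x ρ hρ ↦ ?_⟩
    · have h : retime f d.l (x₀, 1) < retime f d.l (x₀, 1 + d.l) :=
        d.strictMono_retime x₀ (by linarith [d.l_pos])
      rw [d.retime_one, d.retime_of_abs_le x₀
        (by rw [add_sub_cancel_left, abs_of_pos d.l_pos])] at h
      linarith
    · have hle : ‖f (x₀, 1 + d.l)‖ ≤ ‖f (x, 1 + d.l)‖ := hx₀ (mem_univ x)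
      have h1 : 1 ≤ (Ψ (x, ρ)).2 := by
        rw [d.le_symm_snd_iff, d.retime_one]
        exact hρ.1
      have h2 : (Ψ (x, ρ)).2 ≤ 1 + d.l := by
        rw [d.symm_snd_le_iff, d.retime_of_abs_le x
          (by rw [add_sub_cancel_left, abs_of_pos d.l_pos])]
        linarith [hρ.2]
      exact d.norm_f_symm_of_abs_le x ρ (abs_le.2 ⟨by linarith [d.l_pos], by linarith⟩)

/-- **Inner straightening without touching the far half.** Every concordance `f` from `K` to
`K'` can be replaced by a concordance `f₂` from `K` to `K'` with `f₂ (x, t) = t • K x` for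
`t ∈ [1 - δ, 1 + δ]` (some `0 < δ ≤ 1/16`; the cone extends below the annulus) **and
`f₂ (x, t) = f (x, t)` for `t ≥ 3/2`**. This is
`exists_isConcordance_radial` of `ConcordanceStraightening.lean` (same proof: re-time by the
shear, which is the identity for `t ≥ 3/2`, then freeze, which only acts on `t ≤ 1 + 2δ`) with
the locality recorded. Kosinski (1993), II (2.8.2). [cite: Kosinski1993, II (2.8.2)] -/
theorem exists_isConcordance_radial_eqOn {K K' : Knot} (hf : IsConcordance K K' f) :
    ∃ f₂ : (𝕊 1) × ℝ → 𝔼 4, IsConcordance K K' f₂ ∧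
      (∃ δ : ℝ, 0 < δ ∧ δ ≤ 1 / 16 ∧
        ∀ x : 𝕊 1, ∀ t ∈ Icc (1 - δ) (1 + δ), f₂ (x, t) = t • ((K x : 𝕊 3) : 𝔼 4)) ∧
      ∀ (x : 𝕊 1) (t : ℝ), 3 / 2 ≤ t → f₂ (x, t) = f (x, t) := by
  obtain ⟨d⟩ := RetimeData.nonempty hf
  obtain ⟨hf₁, η₀, hη₀, hlev₀⟩ := isConcordance_comp_shearDiffeo_symm hf d
  set f₁ : (𝕊 1) × ℝ → 𝔼 4 := f ∘ d.shearDiffeo.symm with hf₁_def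
  have heq₁ : ∀ (x : 𝕊 1) (t : ℝ), 3 / 2 ≤ t → f₁ (x, t) = f (x, t) := fun x t ht ↦ by
    simp only [hf₁_def, comp_apply, d.shearDiffeo_symm_of_ge x ht]
  obtain ⟨hfs, hfinj, hfimm, hshell, hneat, hK, hK'⟩ := hf₁
  -- shrink the level zone to `[1, 1 + η]` with `η ≤ 1/2`
  set η : ℝ := min η₀ (1 / 2) with hη_def
  have hη : 0 < η := lt_min hη₀ (by norm_num)
  have hη2 : η ≤ 1 / 2 := min_le_right _ _
  have hlev : ∀ x : 𝕊 1, ∀ ρ ∈ Icc (1 : ℝ) (1 + η), ‖f₁ (x, ρ)‖ = ρ := fun x ρ hρ ↦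
    hlev₀ x ρ ⟨hρ.1, hρ.2.trans (by linarith [min_le_left η₀ (1 / 2)])⟩
  -- the far part of the annulus stays outside the radius `m > 1`
  have hcpt : IsCompact ((univ : Set (𝕊 1)) ×ˢ Icc (1 + η) 2) := isCompact_univ.prod isCompact_Icc
  have hne : ((univ : Set (𝕊 1)) ×ˢ Icc (1 + η) 2).Nonempty :=
    ⟨(circlePoint 0, 2), mem_univ _, by constructor <;> linarith⟩
  obtain ⟨q₀, hq₀, hmin⟩ := hcpt.exists_isMinOn hne (hfs.continuous.norm.continuousOn)
  set m : ℝ := ‖f₁ q₀‖ with hm_def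
  have hm1 : 1 < m := by
    obtain ⟨x₀, ρ₀⟩ := q₀
    simp only [mem_prod, mem_univ, true_and, mem_Icc] at hq₀
    rcases eq_or_lt_of_le hq₀.2 with h2 | h2
    · subst h2
      rw [hm_def, hK', norm_smul, norm_eq_of_mem_sphere]
      norm_num
    · exact (hshell x₀ ρ₀ ⟨by linarith [hq₀.1], h2⟩).1
  have hfar : ∀ x : 𝕊 1, ∀ ρ ∈ Icc (1 + η) 2, m ≤ ‖f₁ (x, ρ)‖ := fun x ρ hρ ↦
    hmin ⟨mem_univ _, hρ⟩
  -- the width of the frozen zone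
  set δ : ℝ := min (η / 8) ((m - 1) / 8) with hδ_def
  have hδ : 0 < δ := lt_min (by linarith) (by linarith)
  have hδη : 8 * δ ≤ η := by linarith [min_le_left (η / 8) ((m - 1) / 8)]
  have hδm : 8 * δ ≤ m - 1 := by linarith [min_le_right (η / 8) ((m - 1) / 8)]
  -- norms of the frozen annulus
  have hc_mem : ∀ ρ ∈ Icc (1 : ℝ) (1 + η), freezeTime δ ρ ∈ Icc (1 : ℝ) (1 + η) := fun ρ hρ ↦
    ⟨one_le_freezeTime hδ ρ, (freezeTime_le hρ.1).trans hρ.2⟩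
  have hnorm1 : ∀ x : 𝕊 1, ∀ ρ ∈ Icc (1 : ℝ) (1 + η), ‖freeze f₁ δ (x, ρ)‖ = ρ := by
    intro x ρ hρ
    have hc := hc_mem ρ hρ
    rw [freeze_apply, norm_smul, hlev x _ hc,
      Real.norm_of_nonneg (div_nonneg (by linarith [hρ.1]) (freezeTime_pos hδ ρ).le),
      div_mul_cancel₀ _ (freezeTime_pos hδ ρ).ne']
  have hnorm0 : ∀ x : 𝕊 1, ∀ ρ ∈ Ioc (0 : ℝ) 1, ‖freeze f₁ δ (x, ρ)‖ = ρ := by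
    intro x ρ hρ
    rw [freeze_of_le hδ (by linarith [hρ.2]), norm_smul, hK, norm_eq_of_mem_sphere, mul_one,
      Real.norm_of_nonneg hρ.1.le]
  have hnorm : ∀ x : 𝕊 1, ∀ ρ ∈ Ioo (0 : ℝ) (1 + η), ‖freeze f₁ δ (x, ρ)‖ = ρ := by
    intro x ρ hρ
    rcases le_or_gt ρ 1 with h | h
    · exact hnorm0 x ρ ⟨hρ.1, h⟩
    · exact hnorm1 x ρ ⟨h.le, hρ.2.le⟩
  have hfz_ge : ∀ x : 𝕊 1, ∀ ρ : ℝ, 1 + 2 * δ ≤ ρ → freeze f₁ δ (x, ρ) = f₁ (x, ρ) := fun x ρ hρ ↦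
    freeze_of_ge hδ hρ x
  have hcone : ∀ x : 𝕊 1, ∀ ρ : ℝ, ρ ≤ 1 + δ → freeze f₁ δ (x, ρ) = ρ • ((K x : 𝕊 3) : 𝔼 4) :=
    fun x ρ hρ ↦ by rw [freeze_of_le hδ hρ, hK]
  -- smoothness and differentiability
  have hFs : ContMDiff ((𝓡 1).prod 𝓘(ℝ, ℝ)) 𝓘(ℝ, 𝔼 4) ∞ (freeze f₁ δ) := contMDiff_freeze hfs hδ
  have hdF : ∀ p, MDifferentiableAt ((𝓡 1).prod 𝓘(ℝ, ℝ)) 𝓘(ℝ, 𝔼 4) (freeze f₁ δ) p := fun p ↦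
    hFs.mdifferentiableAt (by simp)
  have hdf : ∀ p, MDifferentiableAt ((𝓡 1).prod 𝓘(ℝ, ℝ)) 𝓘(ℝ, 𝔼 4) f₁ p := fun p ↦
    hfs.mdifferentiableAt (by simp)
  -- `freeze = f₁` near every point with `ρ > 1 + 2δ`
  have hev_far : ∀ x : 𝕊 1, ∀ ρ : ℝ, 1 + 2 * δ < ρ → freeze f₁ δ =ᶠ[𝓝 (x, ρ)] f₁ := by
    intro x ρ hρ
    have hO : IsOpen {q : (𝕊 1) × ℝ | 1 + 2 * δ < q.2} := isOpen_lt continuous_const continuous_snd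
    filter_upwards [hO.mem_nhds hρ] with q hq
    obtain ⟨y, σ⟩ := q
    exact hfz_ge y σ (le_of_lt hq)
  -- `‖freeze‖ = ρ` near every point with `0 < ρ < 1 + η`
  have hev_norm : ∀ x : 𝕊 1, ∀ ρ : ℝ, 0 < ρ → ρ < 1 + η →
      ∀ᶠ q in 𝓝 (x, ρ), ‖freeze f₁ δ q‖ = q.2 := by
    intro x ρ h0 h1
    have hO : IsOpen {q : (𝕊 1) × ℝ | 0 < q.2 ∧ q.2 < 1 + η} :=
      (isOpen_lt continuous_const continuous_snd).inter (isOpen_lt continuous_snd continuous_const)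
    filter_upwards [hO.mem_nhds ⟨h0, h1⟩] with q hq
    obtain ⟨y, σ⟩ := q
    exact hnorm y σ hq
  refine ⟨freeze f₁ δ, ⟨hFs, ?_, ?_, ?_, ?_, ?_, ?_⟩, ⟨δ, hδ, by linarith, fun x t ht ↦ hcone x t ht.2⟩,
    fun x t ht ↦ ?_⟩
  · -- injectivity on the annulus
    rintro ⟨x, ρ⟩ ⟨-, hρ⟩ ⟨x', ρ'⟩ ⟨-, hρ'⟩ h
    have key : ∀ {x x' : 𝕊 1} {ρ ρ' : ℝ}, ρ ∈ Icc (1 : ℝ) 2 → ρ' ∈ Icc (1 : ℝ) 2 →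
        ρ ≤ 1 + 2 * δ → 1 + 2 * δ < ρ' → freeze f₁ δ (x, ρ) ≠ freeze f₁ δ (x', ρ') := by
      intro x x' ρ ρ' hρ hρ' h1 h2 heq
      have hn := congrArg norm heq
      rw [hnorm1 x ρ ⟨hρ.1, by linarith⟩, hfz_ge x' ρ' h2.le] at hn
      rcases le_or_gt ρ' (1 + η) with h3 | h3
      · rw [hlev x' ρ' ⟨hρ'.1, h3⟩] at hn
        linarith
      · have := hfar x' ρ' ⟨h3.le, hρ'.2⟩
        linarith
    rcases le_or_gt ρ (1 + 2 * δ) with h1 | h1 <;> rcases le_or_gt ρ' (1 + 2 * δ) with h2 | h2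
    · -- both frozen: equal norms, then cancel the scalar
      have hn : ρ = ρ' := by
        have := congrArg norm h
        rwa [hnorm1 x ρ ⟨hρ.1, by linarith⟩, hnorm1 x' ρ' ⟨hρ'.1, by linarith⟩] at this
      subst hn
      rw [freeze_apply, freeze_apply] at h
      have hs : ρ / freezeTime δ ρ ≠ 0 :=
        div_ne_zero (by linarith [hρ.1]) (freezeTime_pos hδ ρ).ne'
      have h' := smul_right_injective (𝔼 4) hs h
      have hc : freezeTime δ ρ ∈ Icc (1 : ℝ) 2 :=
        ⟨one_le_freezeTime hδ ρ, (freezeTime_le hρ.1).trans hρ.2⟩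
      have := hfinj ⟨mem_univ x, hc⟩ ⟨mem_univ x', hc⟩ h'
      simp only [Prod.mk.injEq] at this
      rw [this.1]
    · exact absurd h (key hρ hρ' h1 h2)
    · exact absurd h.symm (key hρ' hρ h2 h1)
    · rw [hfz_ge x ρ h1.le, hfz_ge x' ρ' h2.le] at h
      exact hfinj ⟨mem_univ _, hρ⟩ ⟨mem_univ _, hρ'⟩ h
  · -- immersion on the annulus
    rintro ⟨x, ρ⟩ ⟨-, hρ⟩
    rcases lt_or_ge (1 + 2 * δ) ρ with h1 | h1
    · rw [(hev_far x ρ h1).mfderiv_eq]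
      exact hfimm (x, ρ) ⟨mem_univ _, hρ⟩
    · -- in the frozen zone `ρ ≤ 1 + 2δ < 1 + η`
      have hρη : ρ < 1 + η := by linarith
      have hρ0 : (0 : ℝ) < ρ := by
        have : (1 : ℝ) ≤ ρ := hρ.1
        linarith
      -- radial component: `⟪f₂, D w⟫ = ρ w.2`
      have hrad : ∀ w : TangentSpace ((𝓡 1).prod 𝓘(ℝ, ℝ)) ((x, ρ) : (𝕊 1) × ℝ),
          inner ℝ (freeze f₁ δ (x, ρ))
            (mfderiv ((𝓡 1).prod 𝓘(ℝ, ℝ)) 𝓘(ℝ, 𝔼 4) (freeze f₁ δ) (x, ρ) w) = ρ * w.2 :=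
        inner_mfderiv_of_norm_eq_snd (hdF _) (hev_norm x ρ hρ0 hρη)
      -- horizontal component: `D (v, 0) = (ρ / c₂ ρ) • Df₁ (v, 0)` at `(x, c₂ ρ)`
      set σ := freezeTime δ ρ with hσ
      have hσmem : σ ∈ Icc (1 : ℝ) 2 :=
        ⟨one_le_freezeTime hδ ρ, (freezeTime_le hρ.1).trans hρ.2⟩
      have hι : ∀ s : ℝ, MDifferentiableAt (𝓡 1) ((𝓡 1).prod 𝓘(ℝ, ℝ))
          (fun y : 𝕊 1 ↦ ((y, s) : (𝕊 1) × ℝ)) x := fun s ↦ by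
        have h : ContMDiff (𝓡 1) ((𝓡 1).prod 𝓘(ℝ, ℝ)) ∞ (fun y : 𝕊 1 ↦ ((y, s) : (𝕊 1) × ℝ)) :=
          contMDiff_id.prodMk contMDiff_const
        exact h.mdifferentiableAt (by simp)
      -- the horizontal derivative: `Df₂ ∘ inl = (ρ/σ) • Df₁ ∘ inl` (restrict to the circle)
      have hfun : (freeze f₁ δ ∘ fun y : 𝕊 1 ↦ ((y, ρ) : (𝕊 1) × ℝ)) =
          (ρ / σ) • (f₁ ∘ fun y : 𝕊 1 ↦ ((y, σ) : (𝕊 1) × ℝ)) := by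
        funext y
        rfl
      have hl := mfderiv_comp x (hdF (x, ρ)) (hι ρ)
      have hr := mfderiv_comp x (hdf (x, σ)) (hι σ)
      rw [hfun, const_smul_mfderiv ((hdf (x, σ)).comp x (hι σ)), hr, mfderiv_prod_left] at hl
      rw [mfderiv_prod_left] at hl
      -- `hl : (ρ/σ) • (Df₁ ∘ inl) = Df₂ ∘ inl`
      refine (injective_iff_map_eq_zero _).2 fun w hw ↦ ?_
      -- the vertical component of `w` vanishes
      have hw2 : w.2 = 0 := by
        have h := hrad w
        rw [hw] at h
        have h' : inner ℝ (freeze f₁ δ (x, ρ)) (0 : 𝔼 4) = ρ * w.2 := h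
        rw [inner_zero_right] at h'
        exact (mul_eq_zero.1 h'.symm).resolve_left hρ0.ne'
      have hw' : w = ((w.1, 0) : TangentSpace ((𝓡 1).prod 𝓘(ℝ, ℝ)) ((x, ρ) : (𝕊 1) × ℝ)) :=
        Prod.ext rfl hw2
      -- evaluate `hl` at `w.1`
      have e1 : ((mfderiv ((𝓡 1).prod 𝓘(ℝ, ℝ)) 𝓘(ℝ, 𝔼 4) (freeze f₁ δ) (x, ρ)).comp
          (ContinuousLinearMap.inl ℝ (TangentSpace (𝓡 1) x) (TangentSpace 𝓘(ℝ, ℝ) ρ))) w.1 =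
          0 := by
        rw [← hw] 
        conv_rhs => rw [hw']
        rfl
      rw [← hl] at e1
      have e2 : (ρ / σ) • (mfderiv ((𝓡 1).prod 𝓘(ℝ, ℝ)) 𝓘(ℝ, 𝔼 4) f₁ (x, σ))
          ((ContinuousLinearMap.inl ℝ (TangentSpace (𝓡 1) x) (TangentSpace 𝓘(ℝ, ℝ) σ)) w.1) =
          0 := e1
      have hs : ρ / σ ≠ 0 := div_ne_zero hρ0.ne' (freezeTime_pos hδ ρ).ne'
      have e3 := (smul_eq_zero_iff_right hs).1 e2
      have e4 := (injective_iff_map_eq_zero _).1 (hfimm (x, σ) ⟨mem_univ _, hσmem⟩) _ e3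
      have e5 : w.1 = 0 := congrArg Prod.fst e4
      rw [hw', e5]
      rfl
  · -- the open annulus goes into the open shell
    intro x ρ hρ
    rcases le_or_gt ρ (1 + 2 * δ) with h1 | h1
    · rw [hnorm1 x ρ ⟨hρ.1.le, by linarith⟩]
      exact hρ
    · rw [hfz_ge x ρ h1.le]
      exact hshell x ρ hρ
  · -- neatness at both ends
    intro x
    constructor
    · have hev : (fun t ↦ ‖freeze f₁ δ (x, t)‖ ^ 2) =ᶠ[𝓝 1] fun t ↦ t ^ 2 := by
        filter_upwards [Ioo_mem_nhds (by norm_num : (0 : ℝ) < 1) (by linarith : (1 : ℝ) < 1 + η)]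
          with t ht
        rw [hnorm x t ht]
      rw [hev.deriv_eq]
      norm_num
    · have hev : (fun t ↦ ‖freeze f₁ δ (x, t)‖ ^ 2) =ᶠ[𝓝 2] fun t ↦ ‖f₁ (x, t)‖ ^ 2 := by
        filter_upwards [Ioi_mem_nhds (by linarith : (1 : ℝ) + 2 * δ < 2)] with t ht
        rw [hfz_ge x t (le_of_lt ht)]
      rw [hev.deriv_eq]
      exact (hneat x).2
  · intro x
    rw [hcone x 1 (by linarith), one_smul]
  · intro x
    rw [hfz_ge x 2 (by linarith), hK']
  · -- far from the inner end nothing has changed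
    rw [hfz_ge x t (by linarith), heq₁ x t ht]

end Straightening

namespace IsConcordance

/-- **The reflection carries an inner cone to an outer cone** (two-sided version of
`reflect_cone`): if `f (x, s) = s • K x` for `s ∈ [1 - δ, 1 + δ]`, `δ ≤ 1/2`, then
`reflect f (x, t) = t • K x` for `t ∈ [2 - δ, 2 + δ]`. [folklore] -/
theorem reflect_cone' {K : Knot} {f : (𝕊 1) × ℝ → 𝔼 4} {δ : ℝ} (hδ : δ ≤ 1 / 2)
    (hcone : ∀ x : 𝕊 1, ∀ s ∈ Icc (1 - δ) (1 + δ), f (x, s) = s • ((K x : 𝕊 3) : 𝔼 4))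
    (x : 𝕊 1) {t : ℝ} (ht : t ∈ Icc (2 - δ) (2 + δ)) :
    reflect f (x, t) = t • ((K x : 𝕊 3) : 𝔼 4) := by
  have hs : 3 - t ∈ Icc (1 - δ) (1 + δ) := ⟨by linarith [ht.2], by linarith [ht.1]⟩
  rw [reflect_apply, hcone x _ hs,
    shellReflect_smul (norm_eq_of_mem_sphere (K x)) (by linarith [ht.2])]
  congr 1
  ring

/-- **The reflection carries an outer cone to an inner cone**: if `f (x, t) = t • K x` for
`t ∈ [2 - δ, 2 + δ]`, `δ ≤ 1/2`, then `reflect f (x, s) = s • K x` for `s ∈ [1 - δ, 1 + δ]`.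
[folklore] -/
theorem reflect_cone_inner {K : Knot} {f : (𝕊 1) × ℝ → 𝔼 4} {δ : ℝ} (hδ : δ ≤ 1 / 2)
    (hcone : ∀ x : 𝕊 1, ∀ t ∈ Icc (2 - δ) (2 + δ), f (x, t) = t • ((K x : 𝕊 3) : 𝔼 4))
    (x : 𝕊 1) {s : ℝ} (hs : s ∈ Icc (1 - δ) (1 + δ)) :
    reflect f (x, s) = s • ((K x : 𝕊 3) : 𝔼 4) := by
  have ht : 3 - s ∈ Icc (2 - δ) (2 + δ) := ⟨by linarith [hs.2], by linarith [hs.1]⟩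
  rw [reflect_apply, hcone x _ ht,
    shellReflect_smul (norm_eq_of_mem_sphere (K x)) (by linarith [hs.2])]
  congr 1
  ring

/-- **Two-ended straightening of a concordance.** Every concordance from `K` to `K'` can be
replaced by a concordance `f₂` from `K` to `K'` which is the cone `t • K x` for
`t ∈ [1 - δ, 1 + δ]` and the cone `t • K' x` for `t ∈ [2 - δ, 2 + δ]`, for some `0 < δ ≤ 1/4`
(the cones extend a little beyond the annulus `1 ≤ t ≤ 2`, which is convenient for local
arguments at the seams): straighten the inner end (`Straightening.exists_isConcordance_radial_eqOn`),
reflect (`reflect_isConcordance`, `reflect_cone'`: the inner cone becomes an outer cone),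
straighten the new inner end leaving `t ≥ 3/2` untouched, and reflect back (`reflect_cone'`,
`reflect_cone_inner`). Kosinski (1993), II (2.8.2) at both boundary components; the collar
normal form of knot cobordisms used by Fox–Milnor (1966), §1. [cite: Kosinski1993, II (2.8.2)] -/
theorem exists_radial_both {K K' : Knot} {f : (𝕊 1) × ℝ → 𝔼 4} (hf : IsConcordance K K' f) :
    ∃ f₂ : (𝕊 1) × ℝ → 𝔼 4, IsConcordance K K' f₂ ∧ ∃ δ : ℝ, 0 < δ ∧ δ ≤ 1 / 4 ∧
      (∀ x : 𝕊 1, ∀ t ∈ Icc (1 - δ) (1 + δ), f₂ (x, t) = t • ((K x : 𝕊 3) : 𝔼 4)) ∧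
      ∀ x : 𝕊 1, ∀ t ∈ Icc (2 - δ) (2 + δ), f₂ (x, t) = t • ((K' x : 𝕊 3) : 𝔼 4) := by
  -- straighten the inner end
  obtain ⟨g, hg, ⟨δ₁, hδ₁, hδ₁le, hgc⟩, -⟩ := Straightening.exists_isConcordance_radial_eqOn hf
  -- reflect: `h` runs from `K'` to `K` and is the cone `t • K x` near its outer end
  have hh : IsConcordance K' K (reflect g) := reflect_isConcordance hg
  have hhc : ∀ x : 𝕊 1, ∀ t ∈ Icc (2 - δ₁) (2 + δ₁),
      reflect g (x, t) = t • ((K x : 𝕊 3) : 𝔼 4) :=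
    fun x t ht ↦ reflect_cone' (by linarith) hgc x ht
  -- straighten the inner end of `h` without touching `t ≥ 3/2`
  obtain ⟨h₂, hh₂, ⟨δ₂, hδ₂, hδ₂le, hh₂c⟩, heq⟩ :=
    Straightening.exists_isConcordance_radial_eqOn hh
  -- the outer cone of `h` survives in `h₂`
  have hh₂o : ∀ x : 𝕊 1, ∀ t ∈ Icc (2 - δ₁) (2 + δ₁), h₂ (x, t) = t • ((K x : 𝕊 3) : 𝔼 4) := by
    intro x t ht
    rw [heq x t (by linarith [ht.1]), hhc x t ht]
  set δ : ℝ := min δ₁ δ₂ with hδ_def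
  have hδpos : 0 < δ := lt_min hδ₁ hδ₂
  have hδ₁' : δ ≤ δ₁ := min_le_left _ _
  have hδ₂' : δ ≤ δ₂ := min_le_right _ _
  -- reflect back
  refine ⟨reflect h₂, reflect_isConcordance hh₂, δ, hδpos, by linarith, fun x t ht ↦ ?_,
    fun x t ht ↦ ?_⟩
  · exact reflect_cone_inner (by linarith) hh₂o x ⟨by linarith [ht.1], by linarith [ht.2]⟩
  · exact reflect_cone' (by linarith) hh₂c x ⟨by linarith [ht.1], by linarith [ht.2]⟩

end IsConcordance

/-! ### A representative which is conical at all times beyond the seams -/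

/-- The **conical extension** of an annulus `f`: the cone `t • K x` for `t ≤ 1`, the cone
`t • K' x` for `t ≥ 2`, and `f` in between. [folklore] -/
def conical (f : (𝕊 1) × ℝ → 𝔼 4) (K K' : Knot) (p : (𝕊 1) × ℝ) : 𝔼 4 :=
  if p.2 ≤ 1 then p.2 • ((K p.1 : 𝕊 3) : 𝔼 4)
    else if 2 ≤ p.2 then p.2 • ((K' p.1 : 𝕊 3) : 𝔼 4) else f p

/-- Below `t = 1` the conical extension is the cone over `K`. [folklore] -/
theorem conical_of_le_one {f : (𝕊 1) × ℝ → 𝔼 4} {K K' : Knot} (x : 𝕊 1) {t : ℝ} (ht : t ≤ 1) :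
    conical f K K' (x, t) = t • ((K x : 𝕊 3) : 𝔼 4) := by
  simp [conical, ht]

/-- Above `t = 2` the conical extension is the cone over `K'`. [folklore] -/
theorem conical_of_two_le {f : (𝕊 1) × ℝ → 𝔼 4} {K K' : Knot} (x : 𝕊 1) {t : ℝ} (ht : 2 ≤ t) :
    conical f K K' (x, t) = t • ((K' x : 𝕊 3) : 𝔼 4) := by
  have h1 : ¬ t ≤ 1 := by linarith
  simp [conical, h1, ht]

/-- Strictly between `t = 1` and `t = 2` the conical extension is `f`. [folklore] -/
theorem conical_of_mem_Ioo {f : (𝕊 1) × ℝ → 𝔼 4} {K K' : Knot} (x : 𝕊 1) {t : ℝ}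
    (ht : t ∈ Ioo (1 : ℝ) 2) : conical f K K' (x, t) = f (x, t) := by
  have h1 : ¬ t ≤ 1 := not_le.2 ht.1
  have h2 : ¬ (2 : ℝ) ≤ t := not_le.2 ht.2
  simp [conical, h1, h2]

/-- **A concordance which is conical at all times beyond the seams.** Every concordance from `K`
to `K'` can be replaced by a concordance `f₂` with `f₂ (x, t) = t • K x` for **all** `t ≤ 1 + δ`
and `f₂ (x, t) = t • K' x` for **all** `t ≥ 2 - δ` (some `0 < δ ≤ 1/4`): take the two-ended
straightening `f₁` of `exists_radial_both` and replace its (irrelevant) values off the annulus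
by the cones (`conical`); since `f₁` is already conical on `[1 - δ, 1 + δ]` and `[2 - δ, 2 + δ]`,
the new map agrees with `f₁` on the open set `1 - δ < t < 2 + δ` and with the (smooth) cones on
`t < 1 + δ` resp. `t > 2 - δ`, so it is `C^∞` and still a concordance. This is the normal form
in which tubes along the annulus are built (`ConcordanceStripTube.lean`). [folklore] -/
theorem IsConcordance.exists_conical {K K' : Knot} {f : (𝕊 1) × ℝ → 𝔼 4}
    (hf : IsConcordance K K' f) :
    ∃ f₂ : (𝕊 1) × ℝ → 𝔼 4, IsConcordance K K' f₂ ∧ ∃ δ : ℝ, 0 < δ ∧ δ ≤ 1 / 4 ∧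
      (∀ (x : 𝕊 1) (t : ℝ), t ≤ 1 + δ → f₂ (x, t) = t • ((K x : 𝕊 3) : 𝔼 4)) ∧
      ∀ (x : 𝕊 1) (t : ℝ), 2 - δ ≤ t → f₂ (x, t) = t • ((K' x : 𝕊 3) : 𝔼 4) := by
  obtain ⟨f₁, hf₁, δ, hδ, hδ4, hc₁, hc₂⟩ := hf.exists_radial_both
  obtain ⟨hsm, hinj, himm, hshell, hneat, hK, hK'⟩ := hf₁
  set f₂ := conical f₁ K K' with hf₂
  -- `f₂` is the cone over `K` for all `t ≤ 1 + δ`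
  have hlow : ∀ (x : 𝕊 1) (t : ℝ), t ≤ 1 + δ → f₂ (x, t) = t • ((K x : 𝕊 3) : 𝔼 4) := by
    intro x t ht
    rcases le_or_gt t 1 with h | h
    · exact conical_of_le_one x h
    · rw [hf₂, conical_of_mem_Ioo x ⟨h, by linarith⟩]
      exact hc₁ x t ⟨by linarith, ht⟩
  -- `f₂` is the cone over `K'` for all `t ≥ 2 - δ`
  have hhigh : ∀ (x : 𝕊 1) (t : ℝ), 2 - δ ≤ t → f₂ (x, t) = t • ((K' x : 𝕊 3) : 𝔼 4) := by
    intro x t ht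
    rcases le_or_gt 2 t with h | h
    · exact conical_of_two_le x h
    · rw [hf₂, conical_of_mem_Ioo x ⟨by linarith, h⟩]
      exact hc₂ x t ⟨ht, by linarith⟩
  -- `f₂ = f₁` on the open set `1 - δ < t < 2 + δ`
  have heqf : ∀ (x : 𝕊 1) (t : ℝ), t ∈ Ioo (1 - δ) (2 + δ) → f₂ (x, t) = f₁ (x, t) := by
    intro x t ht
    rcases le_or_gt t (1 + δ) with h | h
    · rw [hlow x t h, hc₁ x t ⟨ht.1.le, h⟩]
    rcases le_or_gt (2 - δ) t with h' | h'
    · rw [hhigh x t h', hc₂ x t ⟨h', ht.2.le⟩]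
    · exact conical_of_mem_Ioo x ⟨by linarith, by linarith⟩
  have hev : ∀ (x : 𝕊 1) (t : ℝ), t ∈ Ioo (1 - δ) (2 + δ) → f₂ =ᶠ[𝓝 (x, t)] f₁ := by
    intro x t ht
    have hO : IsOpen {q : (𝕊 1) × ℝ | q.2 ∈ Ioo (1 - δ) (2 + δ)} :=
      isOpen_Ioo.preimage continuous_snd
    filter_upwards [hO.mem_nhds ht] with q hq
    obtain ⟨y, s⟩ := q
    exact heqf y s hq
  have hann : ∀ {t : ℝ}, t ∈ Icc (1 : ℝ) 2 → t ∈ Ioo (1 - δ) (2 + δ) := fun ht ↦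
    ⟨by linarith [ht.1], by linarith [ht.2]⟩
  refine ⟨f₂, ⟨?_, ?_, ?_, ?_, ?_, ?_, ?_⟩, δ, hδ, hδ4, hlow, hhigh⟩
  · -- smoothness, on the open cover `{t < 1 + δ}`, `{t > 2 - δ}`, `{1 - δ < t < 2 + δ}`
    rintro ⟨x, t⟩
    rcases lt_or_ge t (1 + δ) with h | h
    · have he : f₂ =ᶠ[𝓝 (x, t)] coneMap fun p : (𝕊 1) × ℝ ↦ K p.1 := by
        have hO : IsOpen {q : (𝕊 1) × ℝ | q.2 < 1 + δ} := isOpen_lt continuous_snd continuous_const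
        filter_upwards [hO.mem_nhds h] with q hq
        obtain ⟨y, s⟩ := q
        rw [hlow y s (le_of_lt hq), coneMap_apply]
      exact (contMDiff_coneMap _ (K.contMDiff.comp contMDiff_fst) (x, t)).congr_of_eventuallyEq he
    rcases lt_or_ge (2 - δ) t with h' | h'
    · have he : f₂ =ᶠ[𝓝 (x, t)] coneMap fun p : (𝕊 1) × ℝ ↦ K' p.1 := by
        have hO : IsOpen {q : (𝕊 1) × ℝ | 2 - δ < q.2} := isOpen_lt continuous_const continuous_snd
        filter_upwards [hO.mem_nhds h'] with q hq
        obtain ⟨y, s⟩ := q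
        rw [hhigh y s (le_of_lt hq), coneMap_apply]
      exact (contMDiff_coneMap _ (K'.contMDiff.comp contMDiff_fst) (x, t)).congr_of_eventuallyEq he
    · exact (hsm (x, t)).congr_of_eventuallyEq (hev x t ⟨by linarith, by linarith⟩)
  · -- injectivity on the annulus
    rintro ⟨x, t⟩ ⟨-, ht⟩ ⟨x', t'⟩ ⟨-, ht'⟩ h
    rw [heqf x t (hann ht), heqf x' t' (hann ht')] at h
    exact hinj ⟨mem_univ _, ht⟩ ⟨mem_univ _, ht'⟩ h
  · -- immersion on the annulus
    rintro ⟨x, t⟩ ⟨-, ht⟩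
    rw [(hev x t (hann ht)).mfderiv_eq]
    exact himm (x, t) ⟨mem_univ _, ht⟩
  · -- shell
    intro x t ht
    rw [heqf x t ⟨by linarith [ht.1], by linarith [ht.2]⟩]
    exact hshell x t ht
  · -- neatness
    intro x
    have hcurve : ∀ t₀ : ℝ, t₀ ∈ Ioo (1 - δ) (2 + δ) →
        (fun t ↦ ‖f₂ (x, t)‖ ^ 2) =ᶠ[𝓝 t₀] fun t ↦ ‖f₁ (x, t)‖ ^ 2 := by
      intro t₀ ht₀
      filter_upwards [isOpen_Ioo.mem_nhds ht₀] with t ht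
      rw [heqf x t ht]
    obtain ⟨h1, h2⟩ := hneat x
    constructor
    · rw [(hcurve 1 ⟨by linarith, by linarith⟩).deriv_eq]
      exact h1
    · rw [(hcurve 2 ⟨by linarith, by linarith⟩).deriv_eq]
      exact h2
  · intro x
    rw [hlow x 1 (by linarith), one_smul]
  · intro x
    rw [hhigh x 2 (by linarith)]

/-- **Two-ended straightening, existence form**: concordant knots are joined by a concordance
which is the cone over `K` for `t ∈ [1 - δ, 1 + δ]` and the cone over `K'` for
`t ∈ [2 - δ, 2 + δ]`. [cite: Kosinski1993, II (2.8.2)] -/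
theorem IsConcordant.exists_radial_both {K K' : Knot} (h : K.IsConcordant K') :
    ∃ f : (𝕊 1) × ℝ → 𝔼 4, IsConcordance K K' f ∧ ∃ δ : ℝ, 0 < δ ∧ δ ≤ 1 / 4 ∧
      (∀ x : 𝕊 1, ∀ t ∈ Icc (1 - δ) (1 + δ), f (x, t) = t • ((K x : 𝕊 3) : 𝔼 4)) ∧
      ∀ x : 𝕊 1, ∀ t ∈ Icc (2 - δ) (2 + δ), f (x, t) = t • ((K' x : 𝕊 3) : 𝔼 4) := by
  obtain ⟨f₀, hf₀⟩ := h
  exact hf₀.exists_radial_both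

end Knot

end Literature.Topology.FourManifolds
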